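import Summits.SmoothPoincare4.SmoothPoincare4.Theorems.SullivanDualWitnessChargeHelperEndHolomorphic
import Summits.SmoothPoincare4.SmoothPoincare4.Theorems.SullivanDualWitnessChargeHelperMemberSlab
import Literature.Analysis.Complex.RiemannMapping

/-!
# Helper `helper_memberGraphFunction` of line `Sketch` for crux `WitnessCharge`
(item stmt-SmoothPoincare4-7824; route `SullivanDual`, crux
`Summit.SmoothPoincare4.SmoothPoincare4.Theses.SullivanDual.WitnessCharge`; line `Sketch`,
registered stub `helper_memberGraphFunction` (W-B) of the lead's cycle-2 helper skeleton —
confinement step (P3)(a): the holomorphic graph function of a pencil member)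

**The graph function of a pencil member.** Let `J` be STANDARD on the punctured `ε'`-chart-ball
`B_{ε'}` at `p` (closed `ε'`-ball inside the chart target) and let `u : ℂ → Σ∖p` be a pencil member
of intercept `b` (`IsPencilMember J u b`). In the complex flat coordinates write
`Z ξ = (Ycoord p (u ξ)).1`, `W ξ = (Ycoord p (u ξ)).2`, `U = u⁻¹(B_{ε'})`,
`U_R = {ξ ∈ U | R < ‖Z ξ‖}` and `A_R = {z | R < ‖z‖}`. GIVEN that `Z : U_R → A_R` is a bijection
with zero-free derivative (the hypotheses; they are produced by the degree-theoretic neighbour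
`helper_memberGraph_of`), the member is, over `A_R`, the graph `w = h z` of

  `h = W ∘ Function.invFunOn Z U_R`,

and `h` is holomorphic on `A_R`, bounded there by `max ε'⁻¹ ‖b‖`, and tends to `b` at infinity.

Proof — bookkeeping over landed facts, split into an abstract one-variable statement
(`exists_graphFunction_of_bijOn`, for any `Y : ℂ → ℂ × ℂ` holomorphic on an open `{ξ | P ξ}`) and
its instantiation `Y = Ycoord p ∘ u`, `P ξ ↔ u ξ ∈ B_{ε'}`:
* `h (Z ξ) = W ξ` on `U_R` (`Set.InjOn.leftInvOn_invFunOn`); `invFunOn Z U_R` maps `A_R` into `U_R`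
  and `Z ∘ invFunOn Z U_R = id` on `A_R` (`Set.SurjOn.mapsTo_invFunOn`,
  `Set.SurjOn.rightInvOn_invFunOn`), which gives the graph points `Ycoord p (u ξ) = (z, h z)`;
* holomorphy: `Ycoord p ∘ u` is complex differentiable on the open set `U`
  (`helper_endHolomorphic`, E0), so `U_R` is open and `Z`, `W` are complex differentiable on it;
  the inverse of the univalent `Z|U_R` is holomorphic on `Z '' U_R = A_R`
  (`Complex.differentiableOn_invFunOn_image` of `Literature/Analysis/Complex/RiemannMapping.lean`,
  Conway IV.7.6; `Set.BijOn.image_eq`), and `h` is a composition (`DifferentiableOn.comp`);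
* the bound is the slab bound `helper_memberSlab` (W8a) at the point `invFunOn Z U_R z ∈ U`;
* the limit: given `δ > 0`, `‖W ξ − b‖ < δ` off a compact set, contained in a disc `‖ξ‖ ≤ r₀`
  (last clause of `IsPencilMember`); the compact set `u '' closedBall 0 r₀` misses a punctured
  chart-ball `B_η` (`exists_ball_disjoint_of_isCompact`), and for `ξ ∈ U` off `u⁻¹(B_η)` one has
  `‖Z ξ‖ ≤ ‖realify (Ycoord p (u ξ))‖ = ‖e(u ξ) − e p‖⁻¹ ≤ η⁻¹` (`realify_Ycoord`, `norm_inversion`,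
  `norm_realify_sq`); so for `‖z‖ > max R η⁻¹` the preimage `ξ = invFunOn Z U_R z ∈ U_R` has
  `‖ξ‖ > r₀`, whence `‖h z − b‖ = ‖W ξ − b‖ < δ` (`Filter.mem_cocompact` on both sides).
-/

noncomputable section

-- the registered namespace `Summit.SmoothPoincare4.SmoothPoincare4.…` repeats a component
set_option linter.dupNamespace false

open scoped Manifold ContDiff Topology
open Set Filter Literature.Geometry.Kaehler Literature.Geometry.Symplectic
  Literature.Topology.FourManifolds

namespace Summit.SmoothPoincare4.SmoothPoincare4.Theorems.WitnessCharge.PencilIncompleteness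

/-! ### The abstract statement: graphs of holomorphic maps `Y : ℂ → ℂ × ℂ` over exterior discs -/

/-- **Graph function, abstract form.** Let `Y = (Z, W) : ℂ → ℂ × ℂ` be complex differentiable on
an open set `{ξ | P ξ}`, let `Z` restrict to a bijection `U_R = {ξ | P ξ ∧ R < ‖Z ξ‖} → {R < ‖z‖}`
with zero-free derivative, let `‖W‖ ≤ M` on `{ξ | P ξ}`, `W → b` at infinity, and let `Z` be
bounded on the part of `{ξ | P ξ}` inside every disc. Then `h = W ∘ invFunOn Z U_R` is holomorphic
on `{R < ‖z‖}` (holomorphic inverse, `Complex.differentiableOn_invFunOn_image`), satisfies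
`h (Z ξ) = W ξ` on `U_R`, `‖h‖ ≤ M` on `{R < ‖z‖}`, `h → b` at infinity, and every `z` with
`R < ‖z‖` is `Z ξ` for some `ξ ∈ U_R` with `Y ξ = (z, h z)`. -/
theorem exists_graphFunction_of_bijOn (Y : ℂ → ℂ × ℂ) (P : ℂ → Prop) (R M : ℝ) (b : ℂ)
    (hUopen : IsOpen {ξ | P ξ}) (hdiff : DifferentiableOn ℂ Y {ξ | P ξ})
    (hbij : BijOn (fun ξ => (Y ξ).1) {ξ | P ξ ∧ R < ‖(Y ξ).1‖} {z | R < ‖z‖})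
    (hder : ∀ ξ, P ξ → R < ‖(Y ξ).1‖ → deriv (fun ξ => (Y ξ).1) ξ ≠ 0)
    (hslab : ∀ ξ, P ξ → ‖(Y ξ).2‖ ≤ M)
    (hlim : Tendsto (fun ξ => (Y ξ).2) (cocompact ℂ) (𝓝 b))
    (hconf : ∀ r₀ : ℝ, ∃ C : ℝ, ∀ ξ, P ξ → ‖ξ‖ ≤ r₀ → ‖(Y ξ).1‖ ≤ C) :
    ∃ h : ℂ → ℂ, DifferentiableOn ℂ h {z : ℂ | R < ‖z‖} ∧
      (∀ ξ, P ξ → R < ‖(Y ξ).1‖ → h (Y ξ).1 = (Y ξ).2) ∧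
      (∀ z : ℂ, R < ‖z‖ → ‖h z‖ ≤ M) ∧
      Tendsto h (cocompact ℂ) (𝓝 b) ∧
      (∀ z : ℂ, R < ‖z‖ → ∃ ξ, P ξ ∧ Y ξ = (z, h z)) := by
  classical
  -- the inverse `g` of `Z = (Y ·).1` on `U_R`: maps `A_R` into `U_R`, right and left inverse
  set g : ℂ → ℂ := Function.invFunOn (fun ξ => (Y ξ).1) {ξ | P ξ ∧ R < ‖(Y ξ).1‖}
  have hmaps : MapsTo g {z | R < ‖z‖} {ξ | P ξ ∧ R < ‖(Y ξ).1‖} := hbij.surjOn.mapsTo_invFunOn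
  have hright : ∀ z : ℂ, R < ‖z‖ → (Y (g z)).1 = z := fun z hz =>
    hbij.surjOn.rightInvOn_invFunOn hz
  have hleft : ∀ ξ, P ξ → R < ‖(Y ξ).1‖ → g (Y ξ).1 = ξ := fun ξ hP hR =>
    hbij.injOn.leftInvOn_invFunOn ⟨hP, hR⟩
  -- `U_R` is open and `Z`, `W` are holomorphic on it
  have hURopen : IsOpen {ξ | P ξ ∧ R < ‖(Y ξ).1‖} :=
    hdiff.fst.continuousOn.norm.isOpen_inter_preimage hUopen isOpen_Ioi
  have hsub : {ξ | P ξ ∧ R < ‖(Y ξ).1‖} ⊆ {ξ | P ξ} := fun ξ hξ => hξ.1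
  have hZdiff : DifferentiableOn ℂ (fun ξ => (Y ξ).1) {ξ | P ξ ∧ R < ‖(Y ξ).1‖} :=
    hdiff.fst.mono hsub
  have hWdiff : DifferentiableOn ℂ (fun ξ => (Y ξ).2) {ξ | P ξ ∧ R < ‖(Y ξ).1‖} :=
    hdiff.snd.mono hsub
  -- the inverse is holomorphic on `Z '' U_R = A_R` (holomorphic inverse function theorem)
  have hgdiff : DifferentiableOn ℂ g {z | R < ‖z‖} := by
    have h := Complex.differentiableOn_invFunOn_image hURopen hZdiff hbij.injOn
      fun ξ hξ => hder ξ hξ.1 hξ.2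
    rwa [hbij.image_eq] at h
  refine ⟨fun z => (Y (g z)).2, hWdiff.comp hgdiff hmaps,
    fun ξ hP hR => by simp only [hleft ξ hP hR],
    fun z hz => hslab (g z) (hmaps hz).1, ?_, fun z hz => ⟨g z, (hmaps hz).1, ?_⟩⟩
  · -- the limit at infinity
    refine Metric.tendsto_nhds.2 fun δ hδ => ?_
    obtain ⟨K₁, hK₁, hK₁sub⟩ := mem_cocompact.1 (Metric.tendsto_nhds.1 hlim δ hδ)
    obtain ⟨r₀, hr₀⟩ := isBounded_iff_forall_norm_le.1 hK₁.isBounded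
    obtain ⟨C, hC⟩ := hconf r₀
    refine mem_cocompact.2 ⟨Metric.closedBall 0 (max R C), isCompact_closedBall 0 (max R C),
      fun z hz => ?_⟩
    have hzM : max R C < ‖z‖ := not_le.1 fun hle => hz (mem_closedBall_zero_iff.2 hle)
    have hzR : R < ‖z‖ := (le_max_left _ _).trans_lt hzM
    have hzC : C < ‖z‖ := (le_max_right _ _).trans_lt hzM
    have hξ := hmaps hzR
    -- the preimage `g z ∈ U_R` lies outside the disc `‖ξ‖ ≤ r₀`, hence outside `K₁`
    have hr : r₀ < ‖g z‖ := by
      refine not_le.1 fun hle => (hC (g z) hξ.1 hle).not_gt ?_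
      rw [hright z hzR]
      exact hzC
    have hnot : g z ∉ K₁ := fun hmem => (hr₀ _ hmem).not_gt hr
    exact hK₁sub hnot
  · -- the graph point over `z`
    exact Prod.ext (hright z hz) rfl

/-! ### The first flat coordinate along `u` is bounded on bounded parts of `u⁻¹(B_{ε'})` -/

variable {S : HomotopySphere 4} {p : S.carrier} {ε' : ℝ}

/-- The first flat coordinate is bounded by the inverse chart distance:
`‖(Ycoord p x).1‖ ≤ ‖realify (Ycoord p x)‖ = ‖e x − e p‖⁻¹`. -/
theorem norm_fst_Ycoord_le_inv_norm_sub (x : punctured p) :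
    ‖(Ycoord p x).1‖ ≤ ‖extChartAt (𝓡 4) p x.1 - extChartAt (𝓡 4) p p‖⁻¹ := by
  rw [← norm_inversion, ← realify_Ycoord p x]
  refine le_of_pow_le_pow_left₀ two_ne_zero (norm_nonneg _) ?_
  rw [norm_realify_sq]
  exact le_add_of_nonneg_right (sq_nonneg _)

/-- A point of the punctured `ε'`-chart-ball with `η⁻¹ < ‖(Ycoord p x).1‖`, `η > 0`, lies in the
punctured `η`-chart-ball (`‖e x − e p‖ < η`). -/
theorem inBall_of_inv_lt_norm_fst_Ycoord {x : punctured p} (hx : InPuncturedChartBall p ε' x)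
    {η : ℝ} (hη : 0 < η) (hηx : η⁻¹ < ‖(Ycoord p x).1‖) : InPuncturedChartBall p η x := by
  refine ⟨hx.1, ?_⟩
  rw [Metric.mem_ball, dist_eq_norm]
  exact (inv_lt_inv₀ hη (norm_pos_iff.2 (sub_ne_zero_of_ball hx))).1
    (hηx.trans_le (norm_fst_Ycoord_le_inv_norm_sub x))

/-- Along a continuous `u : ℂ → Σ∖p`, the first flat coordinate is bounded on the part of
`u⁻¹(B_{ε'})` inside any closed disc `‖ξ‖ ≤ r₀`: the compact set `u '' closedBall 0 r₀` misses a
punctured chart-ball `B_η` (`exists_ball_disjoint_of_isCompact`), and `‖(Ycoord p (u ξ)).1‖ ≤ η⁻¹`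
for `u ξ ∈ B_{ε'} ∖ B_η`. -/
theorem exists_norm_fst_Ycoord_le_of_norm_le (ε' : ℝ) {u : ℂ → punctured p} (hu : Continuous u)
    (r₀ : ℝ) :
    ∃ C : ℝ, ∀ ξ : ℂ, InPuncturedChartBall p ε' (u ξ) → ‖ξ‖ ≤ r₀ → ‖(Ycoord p (u ξ)).1‖ ≤ C := by
  obtain ⟨η, hη, hηK⟩ :=
    exists_ball_disjoint_of_isCompact ((isCompact_closedBall (0 : ℂ) r₀).image hu)
  refine ⟨η⁻¹, fun ξ hξ hr => le_of_not_gt fun hlt => ?_⟩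
  exact hηK (u ξ) (inBall_of_inv_lt_norm_fst_Ycoord hξ hη hlt)
    (mem_image_of_mem u (mem_closedBall_zero_iff.2 hr))

/-! ### The helper -/

/-- **The graph function of a pencil member (W-B, confinement (P3)(a)).** For `J` standard on the
punctured `ε'`-chart-ball at `p` (closed `ε'`-ball inside the chart target), a pencil member `u` of
intercept `b`, and `R > ε'⁻¹` such that the first flat coordinate `Z = (Ycoord p ∘ u).1` is a
bijection `{ξ | u ξ ∈ B_{ε'}, R < ‖Z ξ‖} → {R < ‖z‖}` with zero-free derivative, there is
`h : ℂ → ℂ`, holomorphic on `{R < ‖z‖}`, with `h (Z ξ) = W ξ` there (`W = (Ycoord p ∘ u).2`),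
`‖h z‖ ≤ max ε'⁻¹ ‖b‖`, `h → b` at infinity, and every `z` with `R < ‖z‖` a graph point
`Ycoord p (u ξ) = (z, h z)`. It is `h = W ∘ invFunOn Z U_R`: holomorphic by `helper_endHolomorphic`
(E0) and the holomorphic inverse `Complex.differentiableOn_invFunOn_image`, bounded by the slab
bound `helper_memberSlab` (W8a), convergent by the asymptotics of the member and properness
bookkeeping (`exists_norm_fst_Ycoord_le_of_norm_le`). -/
theorem helper_memberGraphFunction :
    ∀ (S : HomotopySphere 4) (p : S.carrier)
      (J : ∀ x : punctured p, TangentSpace (𝓡 4) x →L[ℝ] TangentSpace (𝓡 4) x) (ε' : ℝ)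
      (u : ℂ → punctured p) (b : ℂ),
      0 < ε' →
      Metric.closedBall (extChartAt (𝓡 4) p p) ε' ⊆ (extChartAt (𝓡 4) p).target →
      (∀ x : punctured p, InPuncturedChartBall p ε' x →
        ∀ (v : TangentSpace (𝓡 4) x) (b : EuclideanSpace ℝ (Fin 4)),
          inner ℝ (fderiv ℝ inversion (extChartAt (𝓡 4) p x.1 - extChartAt (𝓡 4) p p)
            (mfderiv (𝓡 4) 𝓘(ℝ, EuclideanSpace ℝ (Fin 4))
              (fun z : punctured p => extChartAt (𝓡 4) p z.1) x (J x v))) b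
          = stdSymplecticForm (fderiv ℝ inversion (extChartAt (𝓡 4) p x.1 - extChartAt (𝓡 4) p p)
            (mfderiv (𝓡 4) 𝓘(ℝ, EuclideanSpace ℝ (Fin 4))
              (fun z : punctured p => extChartAt (𝓡 4) p z.1) x v)) b) →
      IsPencilMember J u b →
      ∀ R : ℝ, ε'⁻¹ < R →
        BijOn (fun ξ : ℂ => (Ycoord p (u ξ)).1)
          {ξ : ℂ | InPuncturedChartBall p ε' (u ξ) ∧ R < ‖(Ycoord p (u ξ)).1‖} {z : ℂ | R < ‖z‖} →
        (∀ ξ : ℂ, InPuncturedChartBall p ε' (u ξ) → R < ‖(Ycoord p (u ξ)).1‖ →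
          deriv (fun ξ : ℂ => (Ycoord p (u ξ)).1) ξ ≠ 0) →
        ∃ h : ℂ → ℂ, DifferentiableOn ℂ h {z : ℂ | R < ‖z‖} ∧
          (∀ ξ : ℂ, InPuncturedChartBall p ε' (u ξ) → R < ‖(Ycoord p (u ξ)).1‖ →
            h (Ycoord p (u ξ)).1 = (Ycoord p (u ξ)).2) ∧
          (∀ z : ℂ, R < ‖z‖ → ‖h z‖ ≤ max ε'⁻¹ ‖b‖) ∧
          Tendsto h (cocompact ℂ) (𝓝 b) ∧
          (∀ z : ℂ, R < ‖z‖ → ∃ ξ : ℂ, InPuncturedChartBall p ε' (u ξ) ∧ Ycoord p (u ξ) = (z, h z)) := by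
  intro S p J ε' u b hε' hball hJstd hmem R _hR hbij hder
  have hslab := helper_memberSlab S p J ε' u b hε' hball hJstd hmem
  obtain ⟨hcurve, -, -, -, -, hlim⟩ := hmem
  obtain ⟨hUopen, hdiff, -, -⟩ :=
    helper_endHolomorphic S p J ε' hε' hball hJstd u hcurve.contMDiff hcurve.isJHolomorphic
  exact exists_graphFunction_of_bijOn (fun ξ : ℂ => Ycoord p (u ξ))
    (fun ξ : ℂ => InPuncturedChartBall p ε' (u ξ)) R (max ε'⁻¹ ‖b‖) b hUopen hdiff hbij hder hslab
    hlim (exists_norm_fst_Ycoord_le_of_norm_le ε' hcurve.contMDiff.continuous)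

end Summit.SmoothPoincare4.SmoothPoincare4.Theorems.WitnessCharge.PencilIncompleteness
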